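import Literature.NumberTheory.Sieve.HeathBrownCubicGrossenRayClass
import Literature.NumberTheory.LFunctions.SiegelRealZerosAbstract
import Literature.NumberTheory.LFunctions.SiegelIdealCoefficients
import Literature.NumberTheory.LFunctions.EulerFactorLowerBoundNumberField
import Literature.NumberTheory.LFunctions.DedekindZetaEntireConvexity
import HarnessLib

/-!
# Siegel's theorem for Heath-Brown's real characters of `ℤ[∛2]` and Lemma 9.4 unconditionally

Final analytic input of Lemma 9.4 of D. R. Heath-Brown, *Primes represented by `x³ + 2y³`*, Acta Math. 186
(2001) (= T. Mitsui, *Generalized prime number theorem*, Jap. J. Math. 26 (1956), Lemma 5): the prime number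
theorem for the characters `ν^{(j,k)} mod q` of `K = ℚ(∛2)`, uniformly for `q ≤ (log z)^A`. Page 55: "the
constant `c` in Lemma 9.4 is ineffective" — the uniformity in `q` rests on Siegel's theorem for the REAL
characters `ν^{(0,0)}` (`χ² = 1`, `χ(ε₀) = 1`), and the tree's `grossenCharPNT_of_realZero_bound`
(`HeathBrownCubicGrossenCharPNT`) proves Lemma 9.4 from exactly that input, in the shape produced by the abstract
Siegel machinery of `SiegelTheoremAbstract` / `SiegelRealZerosAbstract` (Montgomery–Vaughan, Theorem 11.14 and
Corollary 11.15, axiomatised as `SiegelFamilyData`). This file INSTANTIATES that machinery and discharges the input: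

* `prodChar χ₁ χ₂` — the product of characters `mod q₁` and `mod q₂` as a character `mod q₁q₂`
  (`MulChar.ofUnitHom` of the product of the unit homomorphisms through the two reductions); `prodChar_toQuotMod`,
  `prodChar_sq_eq_one`, `charAngle_prodChar`, `neg_one_pow_charSign_prodChar`, and **`grossenChar_prodChar`**:
  `ν_{χ₁χ₂}^{(0,0)}(S) = ν_{χ₁}^{(0,0)}(S)ν_{χ₂}^{(0,0)}(S)` on the ideals prime to `q₁q₂`;
* `SiegelIdx` — the family: pairs `(q, χ)`, `q ≥ 1`, `χ mod q` with `χ² = 1`, `χ ≠ χ₀`, `χ(u_E) = 1`; its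
  `L`-functions `L(s, ν^{(0,0)})` (`grossenL`), sizes `Q = q`, product `SiegelIdx.mul` (junk value `i` when
  `χ_iχ_j` is principal, flagged by `Principal i j :↔ prodChar χ_i χ_j = 1`);
* the fields: holomorphy on `U = {Re s > 17/18} ⊇ {|s − 2| ≤ 37/36}`; `Z = ζ₁_K = (s−1)ζ_K(s)` (`dedekindZeta₁`,
  entire, real on `ℝ`, `ζ₁_K(1) = ρ_K > 0`); the bounds `|L| ≤ Bq³` on the disc, `|L(1,χ)| ≤ T(δ)q^δ` and the local
  bound `hloc` of `realZero_bound` (all from `exists_norm_grossenL_le_rpow`); reality (`grossenL_ofReal_im`);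
  **`L(1, χ) ≠ 0`** (`grossenL_one_ne_zero`, Hecke–Landau); the non-negative coefficients of `ζ_K L(χ)` and of
  `ζ_K L(χ_i)L(χ_j)L(χ_iχ_j)` (`SiegelIdealCoefficients.exists_nonneg_coeff_rayClass(_pair)` through
  `grossenL_eq_rayClassLSeries`); and `principal_case`: for `χ_iχ_j` principal the two `L`-functions agree up to the
  Euler factors at `𝔭 ∣ q_iq_j` (`rayClassLSeries_eq_mul_prod`, identity theorem), each `≥ (1 − N𝔭⁻¹)` at `s = 1`,
  and `∏_{𝔭∣q_iq_j}(1 − N𝔭⁻¹) ≫_δ (q_iq_j)^{−δ}` (`exists_prod_one_sub_inv_absNorm_ge`); positivity `L(1,χ) > 0` by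
  continuity from `L(2, χ) > 0` (`re_pos_of_forall_ne_zero`);
* **`hbSiegelFamily : SiegelFamilyData SiegelIdx`**, **`realZero_bound_grossenL`** — Siegel's bound
  `C(ε)q^{−ε} ≤ 1 − β` for real zeros `β ∈ (17/18, 1]` of `L(s, ν^{(0,0)})`, `χ² = 1`, `χ ≠ χ₀`, `χ(u_E) = 1`
  (MV Cor. 11.15; `β = 1` excluded by `L(1,χ) ≠ 0`) — exactly the hypothesis `hS` of
  `grossenCharPNT_of_realZero_bound`; hence
* **`grossenCharPNT_holds : ∀ A > 0, ∃ c C z₀, 0 < c ∧ GrossenCharPNT A c C z₀`** — Heath-Brown's Lemma 9.4 /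
  Mitsui's Lemma 5 for `ℚ(∛2)`, unconditionally, in the shape consumed by `HeathBrown2001_lemma_3_8_of_lemma94`
  (`HeathBrownCubicLemma92`).

## References

* D. R. Heath-Brown, *Primes represented by `x³ + 2y³`*, Acta Math. 186 (2001), §9 Lemma 9.4, p. 55.
  [cite: HeathBrownActa2001, §9 Lemma 9.4]
* T. Mitsui, *Generalized prime number theorem*, Jap. J. Math. 26 (1956), 1–42, Lemma 5. [cite: Mitsui1956, Lemma 5]
* H. L. Montgomery, R. C. Vaughan, *Multiplicative Number Theory I*, CUP 2007, §11.2 Theorem 11.14, Corollary 11.15.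
  [cite: MontgomeryVaughan2007, §11.2 Theorem 11.14]
* C. L. Siegel, *Über die Classenzahl quadratischer Zahlkörper*, Acta Arith. 1 (1935), 83–86. [folklore]

## Mathlib / tree search

Tree: `SiegelFamilyData`, `re_pos_of_forall_ne_zero`, `one_le_re_LSeries_ofReal` (`SiegelTheoremAbstract`),
`SiegelFamilyData.realZero_bound` (`SiegelRealZerosAbstract`), `SiegelIdealCoefficients.exists_nonneg_coeff_rayClass`,
`…_pair` (`SiegelIdealCoefficients`), `exists_prod_one_sub_inv_absNorm_ge`, `mem_primeDivisors_toFinset`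
(`EulerFactorLowerBoundNumberField`), `dedekindZeta₁`, `dedekindZeta₁_differentiable`, `dedekindZeta₁_apply_one`,
`dedekindZeta₁_apply_eq_mul` (`DedekindZetaEntireConvexity`), `entire_sub_one_mul_ofReal_im_eq_zero` (`LSeriesRealReflection`),
`grossenL_one_ne_zero`, `grossenL_ofReal_im`, `grossenL_eq_rayClassLSeries`, `isRayClassCharacter_grossenChar`,
`grossenChar_prime_eq_one_or`, `exists_norm_grossenL_le_rpow`, `sup_span_eq_top_of_not_le` (`HeathBrownCubicGrossenRayClass`),
`rayClassLSeries_congr`, `rayClassLSeries_eq_mul_prod`, `exists_finset_primes_le_and_not_le`, `eqOn_halfPlane_of_eqOn`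
(`RayClassOfIdealHom`), `grossenCharPNT_of_realZero_bound` (`HeathBrownCubicGrossenCharPNT`), `grossenL_ne_zero`,
`differentiableOn_grossenL` (`HeathBrownCubicGrossenLFunction`), `mulChar_unitGen_eq`, `mulChar_neg_one_eq`,
`isUnit_toQuotMod_idealGen_iff` (`HeathBrownCubicGrossen`), `LSeriesSummable_dedekindZeta`, `idealNormCount_one`,
`IdealNormCount.absNorm_span_natCast`. Mathlib: `MulChar.ofUnitHom`, `MulChar.equivToUnitHom`, `Ideal.Quotient.factor`,
`IsCompact.exists_bound_of_continuousOn`, `DifferentiableOn.finsetProd`, `Finset.prod_le_prod_of_subset_of_le_one`.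
`lean search 'SiegelFamilyData (K|\\()|prodChar|grossenCharPNT_holds' --decl`: nothing.
-/

noncomputable section

open NumberField Finset Complex Set Metric IsDedekindDomain
open scoped ComplexConjugate ComplexOrder

namespace Literature.NumberTheory.Sieve.CubicSieve

open LFunctions LFunctions.NumberField LFunctions.CubeRootTwoField CubicPrimes

/-! ### The product character `mod q₁q₂` -/

section ProdChar

variable {q₁ q₂ : ℕ}

/-- `(q₁q₂) ⊆ (q₁)`. [folklore] -/
theorem span_natCast_mul_le_left (q₁ q₂ : ℕ) :
    Ideal.span {((q₁ * q₂ : ℕ) : 𝓞 K)} ≤ Ideal.span {((q₁ : ℕ) : 𝓞 K)} := by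
  rw [Ideal.span_singleton_le_span_singleton, Nat.cast_mul]
  exact dvd_mul_right _ _

/-- `(q₁q₂) ⊆ (q₂)`. [folklore] -/
theorem span_natCast_mul_le_right (q₁ q₂ : ℕ) :
    Ideal.span {((q₁ * q₂ : ℕ) : 𝓞 K)} ≤ Ideal.span {((q₂ : ℕ) : 𝓞 K)} := by
  rw [Ideal.span_singleton_le_span_singleton, Nat.cast_mul]
  exact dvd_mul_left _ _

/-- `(q₁)(q₂) = (q₁q₂)`. [folklore] -/
theorem span_natCast_mul_span_natCast (q₁ q₂ : ℕ) :
    Ideal.span {((q₁ : ℕ) : 𝓞 K)} * Ideal.span {((q₂ : ℕ) : 𝓞 K)} = Ideal.span {((q₁ * q₂ : ℕ) : 𝓞 K)} := by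
  rw [Ideal.span_singleton_mul_span_singleton, Nat.cast_mul]

/-- The reduction `𝓞_K/(q₁q₂) → 𝓞_K/(q₁)`. [folklore] -/
def redLeft (q₁ q₂ : ℕ) : QuotMod (q₁ * q₂) →+* QuotMod q₁ := Ideal.Quotient.factor (span_natCast_mul_le_left q₁ q₂)

/-- The reduction `𝓞_K/(q₁q₂) → 𝓞_K/(q₂)`. [folklore] -/
def redRight (q₁ q₂ : ℕ) : QuotMod (q₁ * q₂) →+* QuotMod q₂ := Ideal.Quotient.factor (span_natCast_mul_le_right q₁ q₂)

/-- `redLeft (x mod q₁q₂) = x mod q₁`. [folklore] -/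
@[simp] theorem redLeft_toQuotMod (x : 𝓞 K) : redLeft q₁ q₂ (toQuotMod (q₁ * q₂) x) = toQuotMod q₁ x :=
  Ideal.Quotient.factor_mk _ x

/-- `redRight (x mod q₁q₂) = x mod q₂`. [folklore] -/
@[simp] theorem redRight_toQuotMod (x : 𝓞 K) : redRight q₁ q₂ (toQuotMod (q₁ * q₂) x) = toQuotMod q₂ x :=
  Ideal.Quotient.factor_mk _ x

/-- **The product character `χ₁χ₂ mod q₁q₂`**: on the units `χ₁(x mod q₁)χ₂(x mod q₂)`, and `0` on the non-units
(Montgomery–Vaughan p. 285: "`χ₁χ₂` is a character modulo `q₁q₂`"). [cite: MontgomeryVaughan2007, §11.2 p. 285] -/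
def prodChar (χ₁ : MulChar (QuotMod q₁) ℂ) (χ₂ : MulChar (QuotMod q₂) ℂ) : MulChar (QuotMod (q₁ * q₂)) ℂ :=
  MulChar.ofUnitHom
    (((MulChar.equivToUnitHom χ₁).comp (Units.map (redLeft q₁ q₂ : QuotMod (q₁ * q₂) →* QuotMod q₁))) *
      ((MulChar.equivToUnitHom χ₂).comp (Units.map (redRight q₁ q₂ : QuotMod (q₁ * q₂) →* QuotMod q₂))))

variable (χ₁ : MulChar (QuotMod q₁) ℂ) (χ₂ : MulChar (QuotMod q₂) ℂ)

/-- The product character on units. [folklore] -/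
theorem prodChar_apply_units (u : (QuotMod (q₁ * q₂))ˣ) :
    prodChar χ₁ χ₂ (u : QuotMod (q₁ * q₂)) = χ₁ (redLeft q₁ q₂ u) * χ₂ (redRight q₁ q₂ u) := by
  rw [prodChar, MulChar.ofUnitHom_coe, MonoidHom.mul_apply, Units.val_mul, MonoidHom.comp_apply,
    MonoidHom.comp_apply, MulChar.coe_equivToUnitHom, MulChar.coe_equivToUnitHom, Units.coe_map, Units.coe_map]
  rfl

/-- **`(χ₁χ₂)(x mod q₁q₂) = χ₁(x mod q₁)χ₂(x mod q₂)`** for `x` a unit modulo `q₁q₂`.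
[cite: MontgomeryVaughan2007, §11.2 p. 285] -/
theorem prodChar_toQuotMod {x : 𝓞 K} (hx : IsUnit (toQuotMod (q₁ * q₂) x)) :
    prodChar χ₁ χ₂ (toQuotMod (q₁ * q₂) x) = χ₁ (toQuotMod q₁ x) * χ₂ (toQuotMod q₂ x) := by
  obtain ⟨u, hu⟩ := hx
  rw [← hu, prodChar_apply_units]
  have h1 : ((redLeft q₁ q₂ : QuotMod (q₁ * q₂) →+* QuotMod q₁)) (u : QuotMod (q₁ * q₂)) = toQuotMod q₁ x := by
    rw [hu, redLeft_toQuotMod]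
  have h2 : ((redRight q₁ q₂ : QuotMod (q₁ * q₂) →+* QuotMod q₂)) (u : QuotMod (q₁ * q₂)) = toQuotMod q₂ x := by
    rw [hu, redRight_toQuotMod]
  rw [h1, h2]

/-- `(χ₁χ₂)² = 1` when `χ₁² = χ₂² = 1`. [folklore] -/
theorem prodChar_sq_eq_one (h₁ : χ₁ ^ 2 = 1) (h₂ : χ₂ ^ 2 = 1) : prodChar χ₁ χ₂ ^ 2 = 1 := by
  apply MulChar.ext
  intro u
  rw [MulChar.pow_apply_coe, MulChar.one_apply_coe, prodChar_apply_units, mul_pow]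
  have e1 : χ₁ (redLeft q₁ q₂ u) ^ 2 = 1 := by
    obtain ⟨w, hw⟩ := (Units.isUnit u).map (redLeft q₁ q₂)
    rw [← hw, ← MulChar.pow_apply_coe, h₁, MulChar.one_apply_coe]
  have e2 : χ₂ (redRight q₁ q₂ u) ^ 2 = 1 := by
    obtain ⟨w, hw⟩ := (Units.isUnit u).map (redRight q₁ q₂)
    rw [← hw, ← MulChar.pow_apply_coe, h₂, MulChar.one_apply_coe]
  rw [e1, e2, one_mul]

/-- `(χ₁χ₂)(u_E) = 1` when `χ₁(u_E) = χ₂(u_E) = 1`. [folklore] -/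
theorem prodChar_unitGen (hq₁ : 1 ≤ q₁) (hq₂ : 1 ≤ q₂) (ht₁ : charAngle χ₁ = 0) (ht₂ : charAngle χ₂ = 0) :
    prodChar χ₁ χ₂ (toQuotMod (q₁ * q₂) (unitGen : 𝓞 K)) = 1 := by
  rw [prodChar_toQuotMod χ₁ χ₂ ((Units.isUnit unitGen).map _), mulChar_unitGen_eq hq₁, mulChar_unitGen_eq hq₂, ht₁, ht₂]
  simp

/-- **`t(χ₁χ₂) = 0`** when `t(χ₁) = t(χ₂) = 0`. [cite: HeathBrownActa2001, §9 p. 52] -/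
theorem charAngle_prodChar (hq₁ : 1 ≤ q₁) (hq₂ : 1 ≤ q₂) (ht₁ : charAngle χ₁ = 0) (ht₂ : charAngle χ₂ = 0) :
    charAngle (prodChar χ₁ χ₂) = 0 := by
  rw [charAngle, prodChar_unitGen χ₁ χ₂ hq₁ hq₂ ht₁ ht₂, Complex.arg_one]

/-- `(−1)^{s(χ₁χ₂)} = (−1)^{s(χ₁)}(−1)^{s(χ₂)}` (`χ(−1) = (−1)^{s(χ)}`). [cite: HeathBrownActa2001, §9 p. 52] -/
theorem neg_one_pow_charSign_prodChar :
    ((-1 : ℂ)) ^ charSign (prodChar χ₁ χ₂) = (-1) ^ charSign χ₁ * (-1) ^ charSign χ₂ := by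
  rw [← mulChar_neg_one_eq, ← mulChar_neg_one_eq, ← mulChar_neg_one_eq]
  have h : (-1 : QuotMod (q₁ * q₂)) = toQuotMod (q₁ * q₂) (-1) := by simp
  have hu : IsUnit (toQuotMod (q₁ * q₂) (-1 : 𝓞 K)) := by rw [← h]; exact isUnit_one.neg
  have h1 : toQuotMod q₁ (-1 : 𝓞 K) = -1 := by simp
  have h2 : toQuotMod q₂ (-1 : 𝓞 K) = -1 := by simp
  rw [h, prodChar_toQuotMod χ₁ χ₂ hu, h1, h2]

/-- `r^{s(χ₁χ₂)} = r^{s(χ₁)}r^{s(χ₂)}` for a sign `r = ±1`. [folklore] -/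
theorem sign_pow_charSign_prodChar {r : ℝ} (hr : r = 1 ∨ r = -1) :
    ((r : ℂ)) ^ charSign (prodChar χ₁ χ₂) = (r : ℂ) ^ charSign χ₁ * (r : ℂ) ^ charSign χ₂ := by
  rcases hr with rfl | rfl
  · simp
  · push_cast; exact neg_one_pow_charSign_prodChar χ₁ χ₂

/-- **`ν_{χ₁χ₂}^{(0,0)}(S) = ν_{χ₁}^{(0,0)}(S)·ν_{χ₂}^{(0,0)}(S)`** on the non-zero ideals `S` prime to `q₁q₂`, when
`t(χ₁) = t(χ₂) = 0` (all three are `χ(g mod ·)·sgn(σ₁g)^{s}` for a generator `g` of `S`).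
[cite: HeathBrownActa2001, §9 (9.2)] -/
theorem grossenChar_prodChar (hq₁ : 1 ≤ q₁) (hq₂ : 1 ≤ q₂) (ht₁ : charAngle χ₁ = 0) (ht₂ : charAngle χ₂ = 0)
    {S : Ideal (𝓞 K)} (hS : S ≠ ⊥) (hScop : S ⊔ Ideal.span {((q₁ * q₂ : ℕ) : 𝓞 K)} = ⊤) :
    grossenChar (one_le_mul hq₁ hq₂) (prodChar χ₁ χ₂) 0 0 S = grossenChar hq₁ χ₁ 0 0 S * grossenChar hq₂ χ₂ 0 0 S := by
  have hg : idealGen S ≠ 0 := idealGen_ne_zero hS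
  have hunit : IsUnit (toQuotMod (q₁ * q₂) (idealGen S)) := (isUnit_toQuotMod_idealGen_iff S).mpr hScop
  rw [grossenChar_zero_zero_of_ne_bot _ _ hS, grossenChar_zero_zero_of_ne_bot _ _ hS,
    grossenChar_zero_zero_of_ne_bot _ _ hS, nu0O_of_charAngle_eq_zero (charAngle_prodChar χ₁ χ₂ hq₁ hq₂ ht₁ ht₂),
    nu0O_of_charAngle_eq_zero ht₁, nu0O_of_charAngle_eq_zero ht₂, prodChar_toQuotMod χ₁ χ₂ hunit]
  have hr : ellO (idealGen S) / |ellO (idealGen S)| = 1 ∨ ellO (idealGen S) / |ellO (idealGen S)| = -1 := by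
    have h0 := ellO_ne_zero hg
    rcases sign_ratio_mem (ellO (idealGen S)) with h | h | h
    · exfalso
      rw [div_eq_zero_iff] at h
      exact h.elim h0 (fun h => h0 (abs_eq_zero.mp h))
    · exact Or.inl h
    · exact Or.inr h
  rw [sign_pow_charSign_prodChar χ₁ χ₂ hr]
  ring

end ProdChar

/-! ### The family of real characters -/

/-- **The members of Siegel's family for `K = ℚ(∛2)`**: pairs `(q, χ)` with `q ≥ 1`, `χ` a character of
`(𝓞_K/(q))^×` with `χ² = 1`, `χ ≠ χ₀` and `χ(u_E) = 1` (`t(χ) = 0`) — Heath-Brown's real characters `ν^{(0,0)}`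
(p. 55: the case `j = k = 0`, `χ` real). [cite: HeathBrownActa2001, §9 p. 55] -/
def SiegelIdx : Type :=
  {i : Σ q : ℕ, MulChar (QuotMod q) ℂ // 1 ≤ i.1 ∧ i.2 ^ 2 = 1 ∧ i.2 ≠ 1 ∧ charAngle i.2 = 0}

namespace SiegelIdx

variable (i j : SiegelIdx)

/-- The modulus `q`. [folklore] -/
abbrev modulus : ℕ := i.1.1

/-- The character `χ mod q`. [folklore] -/
abbrev char : MulChar (QuotMod i.modulus) ℂ := i.1.2

/-- `q ≥ 1`. [folklore] -/
theorem one_le : 1 ≤ i.modulus := i.2.1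

/-- `χ² = 1`. [folklore] -/
theorem sq_eq_one : i.char ^ 2 = 1 := i.2.2.1

/-- `χ ≠ χ₀`. [folklore] -/
theorem ne_one : i.char ≠ 1 := i.2.2.2.1

/-- `t(χ) = 0`. [folklore] -/
theorem charAngle_eq : charAngle i.char = 0 := i.2.2.2.2

/-- `ν^{(0,0)}` is non-trivial `mod q`. [folklore] -/
theorem not_isTrivialMod : ¬ IsTrivialMod i.modulus (grossenChar i.one_le i.char 0 0) :=
  fun h => i.ne_one ((isTrivialMod_iff i.one_le).mp h).1

/-- The module `(q)`. [folklore] -/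
abbrev mod𝔪 : Ideal (𝓞 K) := Ideal.span {((i.modulus : ℕ) : 𝓞 K)}

/-- `(q) ≠ 0`. [folklore] -/
theorem mod𝔪_ne_bot : i.mod𝔪 ≠ ⊥ := span_natCast_ne_bot_of_one_le i.one_le

/-- The prime values `𝔭 ↦ ν^{(0,0)}(𝔭)`. [folklore] -/
abbrev ψ : HeightOneSpectrum (𝓞 K) → ℂ := fun v => grossenChar i.one_le i.char 0 0 v.asIdeal

/-- **The `L`-function `L(s, ν^{(0,0)})`** of the member (`grossenL`, continued to `Re s > 8/9`). [cite: Mitsui1956, Lemma 5] -/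
abbrev L : ℂ → ℂ := grossenL i.one_le i.char 0 0

/-- The prime values off `(q)` are `±1`. [cite: HeathBrownActa2001, §9 p. 55] -/
theorem psi_real : ∀ v : HeightOneSpectrum (𝓞 K), ¬ i.mod𝔪 ≤ v.asIdeal → i.ψ v = 1 ∨ i.ψ v = -1 :=
  fun v hv => grossenChar_prime_eq_one_or i.one_le i.sq_eq_one i.charAngle_eq v hv

/-- `L(s, ν^{(0,0)})` is holomorphic on `Re s > 8/9`. [cite: Mitsui1956, Lemma 5] -/
theorem differentiableOn_L : DifferentiableOn ℂ i.L {s : ℂ | 8 / 9 < s.re} :=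
  differentiableOn_grossenL i.one_le i.char 0 0 i.not_isTrivialMod

/-- `L(s, ν^{(0,0)}) = L_{(q)}(ψ, s)` for `Re s > 1`. [cite: NeukirchANT1999, Ch. VII §8 (8.1) Proposition] -/
theorem L_eq_rayClassLSeries {s : ℂ} (hs : 1 < s.re) : i.L s = rayClassLSeries i.mod𝔪 i.ψ s :=
  grossenL_eq_rayClassLSeries i.one_le i.char 0 0 i.not_isTrivialMod hs

/-- `L(1, ν^{(0,0)}) ≠ 0` (Hecke–Landau). [cite: NeukirchANT1999, Ch. VII §8 Thm. (8.5)] -/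
theorem L_one_ne_zero : i.L 1 ≠ 0 := grossenL_one_ne_zero i.one_le i.ne_one i.charAngle_eq

/-- `L(σ, ν^{(0,0)})` is real for real `σ > 8/9`. [cite: MontgomeryVaughan2007, §10.1] -/
theorem L_ofReal_im {σ : ℝ} (hσ : 8 / 9 < σ) : (i.L σ).im = 0 :=
  grossenL_ofReal_im i.one_le i.sq_eq_one i.ne_one i.charAngle_eq hσ

/-- The genuine product member `(q_iq_j, χ_iχ_j)` (for `χ_iχ_j` non-principal). [cite: MontgomeryVaughan2007, §11.2 p. 285] -/
def prodIdx (i j : SiegelIdx) (h : ¬ prodChar i.char j.char = 1) : SiegelIdx :=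
  ⟨⟨i.modulus * j.modulus, prodChar i.char j.char⟩, one_le_mul i.one_le j.one_le,
    prodChar_sq_eq_one _ _ i.sq_eq_one j.sq_eq_one, h,
    charAngle_prodChar _ _ i.one_le j.one_le i.charAngle_eq j.charAngle_eq⟩

open Classical in
/-- **The product member `χ_iχ_j mod q_iq_j`** (junk value `i` when `χ_iχ_j` is principal). [cite: MontgomeryVaughan2007, §11.2 p. 285] -/
def mul (i j : SiegelIdx) : SiegelIdx := if h : prodChar i.char j.char = 1 then i else prodIdx i j h

/-- "`χ_iχ_j` is principal". [folklore] -/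
def Principal (i j : SiegelIdx) : Prop := prodChar i.char j.char = 1

/-- The junk value in the principal case. [folklore] -/
theorem mul_of_principal (h : Principal i j) : mul i j = i := by
  unfold SiegelIdx.mul; exact dif_pos h

/-- The product member in the non-principal case. [folklore] -/
theorem mul_of_not_principal (h : ¬ Principal i j) : mul i j = prodIdx i j h := by
  unfold SiegelIdx.mul; exact dif_neg h

/-- `Q(χ_iχ_j) ≤ Q(χ_i)Q(χ_j)` (`q_iq_j`, or `q_i ≤ q_iq_j` for the junk value). [cite: MontgomeryVaughan2007, §11.2 p. 285] -/
theorem modulus_mul_le : ((mul i j).modulus : ℝ) ≤ (i.modulus : ℝ) * (j.modulus : ℝ) := by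
  by_cases h : Principal i j
  · rw [mul_of_principal i j h]
    have hj : (1 : ℝ) ≤ (j.modulus : ℝ) := by exact_mod_cast j.one_le
    have hi : (0 : ℝ) ≤ (i.modulus : ℝ) := Nat.cast_nonneg _
    calc (i.modulus : ℝ) = (i.modulus : ℝ) * 1 := (mul_one _).symm
      _ ≤ (i.modulus : ℝ) * (j.modulus : ℝ) := mul_le_mul_of_nonneg_left hj hi
  · rw [mul_of_not_principal i j h]
    show ((i.modulus * j.modulus : ℕ) : ℝ) ≤ _
    push_cast
    exact le_rfl

/-- **`L(s, χ_iχ_j) = L_{(q_i)(q_j)}(ψ_iψ_j, s)` for `Re s > 1`** when `χ_iχ_j` is not principal.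
[cite: MontgomeryVaughan2007, §11.2 p. 285] -/
theorem L_mul_eq {s : ℂ} (h : ¬ Principal i j) (hs : 1 < s.re) :
    (mul i j).L s = rayClassLSeries (i.mod𝔪 * j.mod𝔪) (fun v => i.ψ v * j.ψ v) s := by
  rw [mul_of_not_principal i j h]
  show grossenL (one_le_mul i.one_le j.one_le) (prodChar i.char j.char) 0 0 s = _
  have hnt : ¬ IsTrivialMod (i.modulus * j.modulus) (grossenChar (one_le_mul i.one_le j.one_le) (prodChar i.char j.char) 0 0) :=
    fun h' => h ((isTrivialMod_iff (one_le_mul i.one_le j.one_le)).mp h').1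
  rw [grossenL_eq_rayClassLSeries _ _ 0 0 hnt hs, span_natCast_mul_span_natCast]
  refine rayClassLSeries_congr (span_natCast_ne_bot_of_one_le (one_le_mul i.one_le j.one_le)) (fun v hv => ?_) s
  exact grossenChar_prodChar _ _ i.one_le j.one_le i.charAngle_eq j.charAngle_eq v.ne_bot
    (sup_span_eq_top_of_not_le (one_le_mul i.one_le j.one_le) hv)

/-- For `χ_iχ_j` principal, `ψ_i = ψ_j` on the primes `𝔭 ∤ q_iq_j`. [cite: MontgomeryVaughan2007, §11.2 p. 285] -/
theorem psi_eq_of_principal (h : Principal i j) (v : HeightOneSpectrum (𝓞 K))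
    (hv : ¬ Ideal.span {((i.modulus * j.modulus : ℕ) : 𝓞 K)} ≤ v.asIdeal) : i.ψ v = j.ψ v := by
  have hprod := grossenChar_prodChar i.char j.char i.one_le j.one_le i.charAngle_eq j.charAngle_eq v.ne_bot
    (sup_span_eq_top_of_not_le (one_le_mul i.one_le j.one_le) hv)
  have h1 : grossenChar (one_le_mul i.one_le j.one_le) (prodChar i.char j.char) 0 0 v.asIdeal = 1 := by
    have htriv : IsTrivialMod (i.modulus * j.modulus)
        (grossenChar (one_le_mul i.one_le j.one_le) (prodChar i.char j.char) 0 0) := by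
      rw [isTrivialMod_iff]; exact ⟨h, rfl, rfl⟩
    exact htriv _ v.ne_bot (sup_span_eq_top_of_not_le (one_le_mul i.one_le j.one_le) hv)
  rw [h1] at hprod
  have hvi : ¬ i.mod𝔪 ≤ v.asIdeal := fun hle => hv ((span_natCast_mul_le_left _ _).trans hle)
  have hvj : ¬ j.mod𝔪 ≤ v.asIdeal := fun hle => hv ((span_natCast_mul_le_right _ _).trans hle)
  rcases i.psi_real v hvi with hi | hi <;> rcases j.psi_real v hvj with hj | hj
  · exact hi.trans hj.symm
  · exfalso; simp only [ψ] at hi hj; rw [hi, hj] at hprod; norm_num at hprod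
  · exfalso; simp only [ψ] at hi hj; rw [hi, hj] at hprod; norm_num at hprod
  · exact hi.trans hj.symm

end SiegelIdx

/-! ### The zeta factor `Z = ζ₁_K` -/

/-- `ζ₁_K` is real on the real axis. [folklore] -/
theorem dedekindZeta₁_ofReal_im (σ : ℝ) : (dedekindZeta₁ K σ).im = 0 :=
  entire_sub_one_mul_ofReal_im_eq_zero (a := fun n => (idealNormCount K n : ℂ)) (fun n => Complex.conj_natCast _)
    (x₀ := 1) (dedekindZeta₁_differentiable K) (fun s hs => by rw [dedekindZeta₁_apply_eq_mul hs]; rfl) σ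

/-- `Re ζ_K(σ) ≥ 1` for real `σ > 1`. [folklore] -/
theorem one_le_dedekindZeta_ofReal_re {σ : ℝ} (hσ : 1 < σ) : 1 ≤ (_root_.NumberField.dedekindZeta K σ).re := by
  rw [dedekindZeta_eq_LSeries]
  refine one_le_re_LSeries_ofReal (fun n => ?_) (by simp [idealNormCount_one]) ?_
  · exact Nat.cast_nonneg _
  · exact LSeriesSummable_dedekindZeta (by simpa using hσ)

/-- `Re ζ₁_K(σ) > 0` for `1 < σ`. [folklore] -/
theorem dedekindZeta₁_ofReal_re_pos {σ : ℝ} (hσ : 1 < σ) : 0 < (dedekindZeta₁ K σ).re := by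
  rw [dedekindZeta₁_apply_eq_mul (by simpa using hσ), show (σ : ℂ) - 1 = ((σ - 1 : ℝ) : ℂ) by push_cast; ring,
    Complex.re_ofReal_mul]
  exact mul_pos (by linarith) (by linarith [one_le_dedekindZeta_ofReal_re hσ])

/-- The disc `|s − 2| ≤ 37/36` lies in `35/36 ≤ Re s ≤ 4`, `|Im s| ≤ 37/36`. [folklore] -/
theorem bounds_of_mem_closedBall {s : ℂ} (hs : s ∈ closedBall (2 : ℂ) (37 / 36)) :
    35 / 36 ≤ s.re ∧ s.re ≤ 4 ∧ |s.im| ≤ 37 / 36 := by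
  rw [mem_closedBall, dist_eq_norm] at hs
  have h1 := (abs_re_le_norm (s - 2)).trans hs
  have h2 := (abs_im_le_norm (s - 2)).trans hs
  simp only [sub_re, sub_im] at h1 h2
  norm_num at h1 h2
  rw [abs_le] at h1
  exact ⟨by linarith [h1.1], by linarith [h1.2], h2⟩

/-! ### Positivity of `L(1, χ)` -/

namespace SiegelIdx

variable (i j : SiegelIdx)

/-- **`ζ₁_K(s)L(s, χ) = (s − 1)∑ a(n)n^{-s}` with `a ≥ 0`, `a(1) = 1`** (the field `coeff₁`).
[cite: MontgomeryVaughan2007, §11.2 p. 285] -/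
theorem exists_coeff₁ : ∃ a : ℕ → ℂ, 0 ≤ a ∧ a 1 = 1 ∧ (∀ s : ℂ, 1 < s.re → LSeriesSummable a s) ∧
    ∀ s : ℂ, 1 < s.re → dedekindZeta₁ K s * i.L s = (s - 1) * LSeries a s := by
  obtain ⟨a, ha0, ha1, hsum, hL⟩ := SiegelIdealCoefficients.exists_nonneg_coeff_rayClass_pair i.mod𝔪_ne_bot i.psi_real
  refine ⟨a, ha0, ha1, hsum, fun s hs => ?_⟩
  rw [hL s hs, dedekindZeta₁_apply_eq_mul hs, i.L_eq_rayClassLSeries hs]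
  ring

/-- `Re L(2, χ) > 0` (`ζ₁_K(2)L(2,χ) = ∑ a(n)n^{-2} ≥ 1`, `ζ₁_K(2) > 0`). [folklore] -/
theorem L_two_re_pos : 0 < (i.L ((2 : ℝ) : ℂ)).re := by
  obtain ⟨a, ha0, ha1, hsum, hL⟩ := i.exists_coeff₁
  have h2 : (1 : ℝ) < (((2 : ℝ) : ℂ)).re := by simp
  have h := hL _ h2
  have hZim := dedekindZeta₁_ofReal_im (2 : ℝ)
  have hZre := dedekindZeta₁_ofReal_re_pos (σ := (2 : ℝ)) (by norm_num)
  have hZ : dedekindZeta₁ K ((2 : ℝ) : ℂ) = (((dedekindZeta₁ K ((2 : ℝ) : ℂ)).re : ℝ) : ℂ) :=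
    Complex.ext (by rw [Complex.ofReal_re]) (by rw [Complex.ofReal_im, hZim])
  have hone : (((2 : ℝ) : ℂ)) - 1 = 1 := by norm_num
  rw [hone, one_mul, hZ] at h
  have hLval : i.L ((2 : ℝ) : ℂ) = LSeries a ((2 : ℝ) : ℂ) / (((dedekindZeta₁ K ((2 : ℝ) : ℂ)).re : ℝ) : ℂ) := by
    rw [eq_div_iff (by exact_mod_cast hZre.ne'), mul_comm, h]
  rw [hLval, Complex.div_ofReal_re]
  exact div_pos (by linarith [one_le_re_LSeries_ofReal ha0 ha1 (hsum _ h2)]) hZre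

/-- **`L(1, χ) > 0`**: `L(σ, χ)` is real, continuous and zero-free on `[1, 2]` and positive at `2`.
[cite: MontgomeryVaughan2007, §11.2 p. 285] -/
theorem L_one_re_pos : 0 < (i.L 1).re := by
  have hd := i.differentiableOn_L
  have h := re_pos_of_forall_ne_zero (f := i.L) (u := 1) (v := 2) one_le_two ?_ ?_ ?_ i.L_two_re_pos
  · simpa using h
  · have hmaps : MapsTo (fun σ : ℝ => (σ : ℂ)) (Icc (1 : ℝ) 2) {s : ℂ | 8 / 9 < s.re} := fun σ hσ => by
      simp only [Set.mem_setOf_eq, Complex.ofReal_re]; linarith [hσ.1]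
    exact ContinuousOn.comp (g := i.L) (f := fun σ : ℝ => (σ : ℂ)) hd.continuousOn
      Complex.continuous_ofReal.continuousOn hmaps
  · intro σ hσ; exact i.L_ofReal_im (by linarith [hσ.1])
  · intro σ hσ
    rcases hσ.1.eq_or_lt with h1 | h1
    · rw [← h1]; simpa using i.L_one_ne_zero
    · exact grossenL_ne_zero i.one_le i.char 0 0 i.not_isTrivialMod (by simpa using h1)

/-- `L(1, χ)` is a positive real number. [folklore] -/
theorem L_one_eq_ofReal : i.L 1 = (((i.L 1).re : ℝ) : ℂ) :=
  Complex.ext (by simp) (by simpa using i.L_ofReal_im (σ := 1) (by norm_num))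

end SiegelIdx

/-! ### The Euler factors at the bad primes (`principal_case`) -/

/-- `N𝔭 ≥ 2` for a non-zero prime `𝔭`. [folklore] -/
theorem two_le_absNorm_heightOne (v : HeightOneSpectrum (𝓞 K)) : 2 ≤ Ideal.absNorm v.asIdeal := by
  have h0 : Ideal.absNorm v.asIdeal ≠ 0 := by rw [Ne, Ideal.absNorm_eq_zero_iff]; exact v.ne_bot
  have h1 : Ideal.absNorm v.asIdeal ≠ 1 := by rw [Ne, Ideal.absNorm_eq_one_iff]; exact v.isPrime.ne_top
  omega

/-- The finite Euler product `∏_{𝔭∈S}(1 − ψ(𝔭)N𝔭^{-s})⁻¹` is holomorphic on `Re s > 0` (`|ψ| ≤ 1`, `N𝔭 ≥ 2`).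
[folklore] -/
theorem differentiableOn_eulerProd (S : Finset (HeightOneSpectrum (𝓞 K))) {ψ : HeightOneSpectrum (𝓞 K) → ℂ}
    (hψ : ∀ v ∈ S, ‖ψ v‖ ≤ 1) :
    DifferentiableOn ℂ (fun s : ℂ => ∏ v ∈ S, (1 - ψ v * ((Ideal.absNorm v.asIdeal : ℕ) : ℂ) ^ (-s))⁻¹)
      {s : ℂ | 0 < s.re} := by
  refine DifferentiableOn.fun_finsetProd fun v hv => ?_
  intro s hs
  have hN : (2 : ℝ) ≤ (Ideal.absNorm v.asIdeal : ℕ) := by exact_mod_cast two_le_absNorm_heightOne v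
  have hN0 : ((Ideal.absNorm v.asIdeal : ℕ) : ℂ) ≠ 0 := by
    have : (0 : ℝ) < (Ideal.absNorm v.asIdeal : ℕ) := by linarith
    exact_mod_cast this.ne'
  have hne : 1 - ψ v * ((Ideal.absNorm v.asIdeal : ℕ) : ℂ) ^ (-s) ≠ 0 := by
    intro h0
    have h1 : ψ v * ((Ideal.absNorm v.asIdeal : ℕ) : ℂ) ^ (-s) = 1 := by linear_combination -h0
    have h2 : ‖ψ v * ((Ideal.absNorm v.asIdeal : ℕ) : ℂ) ^ (-s)‖ < 1 := by
      rw [norm_mul, Complex.norm_natCast_cpow_of_pos (by have := two_le_absNorm_heightOne v; omega), Complex.neg_re]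
      have h3 : ((Ideal.absNorm v.asIdeal : ℕ) : ℝ) ^ (-s.re) < 1 :=
        Real.rpow_lt_one_of_one_lt_of_neg (by linarith) (by simpa using hs)
      calc ‖ψ v‖ * ((Ideal.absNorm v.asIdeal : ℕ) : ℝ) ^ (-s.re) ≤ 1 * ((Ideal.absNorm v.asIdeal : ℕ) : ℝ) ^ (-s.re) := by
            gcongr; exact hψ v hv
        _ < 1 := by rw [one_mul]; exact h3
    rw [h1, norm_one] at h2
    exact lt_irrefl _ h2
  have hdiff : DifferentiableAt ℂ (fun s : ℂ => 1 - ψ v * ((Ideal.absNorm v.asIdeal : ℕ) : ℂ) ^ (-s)) s :=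
    ((differentiableAt_id.neg.const_cpow (Or.inl hN0)).const_mul (ψ v)).const_sub 1
  exact (hdiff.inv hne).differentiableWithinAt

/-- **The Euler factors at `s = 1` for a real `ψ`**: `∏_{𝔭∈S}(1 − ψ(𝔭)N𝔭⁻¹)⁻¹` is a real number `e` with
`∏_{𝔭∈S}(1 − N𝔭⁻¹) ≤ e` and `e · ∏_{𝔭∈S}(1 − N𝔭⁻¹) ≤ 1`. [cite: MontgomeryVaughan2007, §11.2 p. 285] -/
theorem eulerProd_one_real (S : Finset (HeightOneSpectrum (𝓞 K))) {ψ : HeightOneSpectrum (𝓞 K) → ℂ}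
    (hψ : ∀ v ∈ S, ψ v = 1 ∨ ψ v = -1) :
    ∃ e : ℝ, (∏ v ∈ S, (1 - ψ v * ((Ideal.absNorm v.asIdeal : ℕ) : ℂ) ^ (-(1 : ℂ)))⁻¹) = (e : ℂ) ∧
      (∏ v ∈ S, (1 - ((Ideal.absNorm v.asIdeal : ℕ) : ℝ)⁻¹)) ≤ e ∧
      e * (∏ v ∈ S, (1 - ((Ideal.absNorm v.asIdeal : ℕ) : ℝ)⁻¹)) ≤ 1 ∧ 0 < e := by
  classical
  induction S using Finset.induction_on with
  | empty => exact ⟨1, by simp, by simp, by simp, one_pos⟩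
  | @insert v S hvS ih =>
    obtain ⟨e, he, hle, hel, he0⟩ := ih fun w hw => hψ w (Finset.mem_insert_of_mem hw)
    have hN : (2 : ℝ) ≤ (Ideal.absNorm v.asIdeal : ℕ) := by exact_mod_cast two_le_absNorm_heightOne v
    set N : ℝ := ((Ideal.absNorm v.asIdeal : ℕ) : ℝ) with hNdef
    have hN0 : 0 < N := by linarith
    have hcpow : ((Ideal.absNorm v.asIdeal : ℕ) : ℂ) ^ (-(1 : ℂ)) = ((N⁻¹ : ℝ) : ℂ) := by
      rw [Complex.cpow_neg_one, hNdef]; push_cast; rfl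
    -- the new factor `f = (1 − r/N)⁻¹`, `r = ±1`
    obtain ⟨r, hr, hrv⟩ : ∃ r : ℝ, (r = 1 ∨ r = -1) ∧ ψ v = (r : ℂ) := by
      rcases hψ v (Finset.mem_insert_self v S) with h | h
      · exact ⟨1, Or.inl rfl, by rw [h]; simp⟩
      · exact ⟨-1, Or.inr rfl, by rw [h]; simp⟩
    have hf0 : 0 < 1 - r / N := by
      rcases hr with rfl | rfl
      · rw [sub_pos, div_lt_one hN0]; linarith
      · have : 0 < 1 / N := by positivity
        rw [neg_div]; linarith
    refine ⟨(1 - r / N)⁻¹ * e, ?_, ?_, ?_, mul_pos (inv_pos.mpr hf0) he0⟩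
    · rw [Finset.prod_insert hvS, he, hrv, hcpow]
      push_cast
      rw [div_eq_mul_inv]
    · rw [Finset.prod_insert hvS, ← hNdef]
      have hN1 : N⁻¹ ≤ 1 := inv_le_one_of_one_le₀ (by linarith)
      have hNi := inv_pos.mpr hN0
      refine mul_le_mul ?_ hle (Finset.prod_nonneg fun w _ => ?_) (inv_pos.mpr hf0).le
      · -- `1 − N⁻¹ ≤ (1 − r/N)⁻¹`, i.e. `(1 − N⁻¹)(1 − r/N) ≤ 1`
        rw [show (1 - r / N)⁻¹ = 1 / (1 - r / N) from inv_eq_one_div _, le_div_iff₀ hf0]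
        rcases hr with rfl | rfl
        · rw [one_div]; nlinarith [mul_nonneg hNi.le (show (0 : ℝ) ≤ 2 - N⁻¹ by linarith)]
        · rw [neg_div, one_div, sub_neg_eq_add]; nlinarith [mul_pos hNi hNi]
      · have hw : (2 : ℝ) ≤ (Ideal.absNorm w.asIdeal : ℕ) := by exact_mod_cast two_le_absNorm_heightOne w
        rw [sub_nonneg]
        exact inv_le_one_of_one_le₀ (by linarith)
    · rw [Finset.prod_insert hvS, ← hNdef]
      have hNi := inv_pos.mpr hN0
      -- `(1 − r/N)⁻¹ (1 − 1/N) ≤ 1`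
      have hfac : (1 - r / N)⁻¹ * (1 - N⁻¹) ≤ 1 := by
        rw [inv_mul_le_iff₀ hf0, mul_one]
        rcases hr with rfl | rfl
        · rw [one_div]
        · rw [neg_div, one_div]; linarith
      have hprod0 : 0 ≤ ∏ w ∈ S, (1 - ((Ideal.absNorm w.asIdeal : ℕ) : ℝ)⁻¹) := by
        refine Finset.prod_nonneg fun w _ => ?_
        have hw : (2 : ℝ) ≤ (Ideal.absNorm w.asIdeal : ℕ) := by exact_mod_cast two_le_absNorm_heightOne w
        rw [sub_nonneg]; exact inv_le_one_of_one_le₀ (by linarith)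
      calc (1 - r / N)⁻¹ * e * ((1 - N⁻¹) * ∏ w ∈ S, (1 - ((Ideal.absNorm w.asIdeal : ℕ) : ℝ)⁻¹))
          = ((1 - r / N)⁻¹ * (1 - N⁻¹)) * (e * ∏ w ∈ S, (1 - ((Ideal.absNorm w.asIdeal : ℕ) : ℝ)⁻¹)) := by ring
        _ ≤ 1 * 1 := mul_le_mul hfac hel (mul_nonneg he0.le hprod0) zero_le_one
        _ = 1 := one_mul _

/-! ### The Siegel family and the real-zero bound -/

/-- The local bound near `s = 1`: for `δ > 0` there are `r > 0`, `T` with `‖L(z, χ)‖ ≤ T q^δ` on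
`|Im z| ≤ r`, `1 − 2r ≤ Re z ≤ 1 + r` (hypothesis `hloc` of `realZero_bound`). [cite: MontgomeryVaughan2007, §11.2 Corollary 11.15] -/
theorem hloc_grossenL (δ : ℝ) (hδ : 0 < δ) : ∃ r : ℝ, 0 < r ∧ ∃ T : ℝ, ∀ (i : SiegelIdx) (z : ℂ), |z.im| ≤ r →
    1 - 2 * r ≤ z.re → z.re ≤ 1 + r → ‖i.L z‖ ≤ T * (i.modulus : ℝ) ^ δ := by
  obtain ⟨T, hT0, hT⟩ := exists_norm_grossenL_le_rpow (δ := min δ 3) (lt_min hδ (by norm_num)) (min_le_right _ _)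
  refine ⟨min δ 3 / 108, by positivity, 2 * T, fun i z hzim hzre1 hzre2 => ?_⟩
  have hδ3 : min δ 3 ≤ 3 := min_le_right _ _
  have hq1 : (1 : ℝ) ≤ i.modulus := by exact_mod_cast i.one_le
  have h := hT i.modulus i.one_le i.char i.ne_one z (by linarith) (by linarith)
  refine h.trans ?_
  have hpow : (i.modulus : ℝ) ^ (min δ 3) ≤ (i.modulus : ℝ) ^ δ :=
    Real.rpow_le_rpow_of_exponent_le hq1 (min_le_left _ _)
  have him : |z.im| + 1 ≤ 2 := by linarith
  calc T * (i.modulus : ℝ) ^ (min δ 3) * (|z.im| + 1) ≤ T * (i.modulus : ℝ) ^ δ * 2 := by gcongr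
    _ = 2 * T * (i.modulus : ℝ) ^ δ := by ring

/-- The global bound `‖L(s, χ)‖ ≤ B q³` on the disc `|s − 2| ≤ 37/36`. [folklore] -/
theorem exists_bound_L_closedBall : ∃ B : ℝ, 0 ≤ B ∧ ∀ (i : SiegelIdx) (s : ℂ), s ∈ closedBall (2 : ℂ) (37 / 36) →
    ‖i.L s‖ ≤ B * (i.modulus : ℝ) ^ (3 : ℝ) := by
  obtain ⟨T, hT0, hT⟩ := exists_norm_grossenL_le_rpow (δ := 3) (by norm_num) le_rfl
  refine ⟨T * 3, by positivity, fun i s hs => ?_⟩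
  obtain ⟨h1, h2, h3⟩ := bounds_of_mem_closedBall hs
  have h := hT i.modulus i.one_le i.char i.ne_one s (by linarith) h2
  refine h.trans ?_
  have him : |s.im| + 1 ≤ 3 := by linarith
  calc T * (i.modulus : ℝ) ^ (3 : ℝ) * (|s.im| + 1) ≤ T * (i.modulus : ℝ) ^ (3 : ℝ) * 3 := by gcongr
    _ = T * 3 * (i.modulus : ℝ) ^ (3 : ℝ) := by ring

/-- A bound for `|ζ₁_K|` on the disc. [folklore] -/
theorem exists_bound_dedekindZeta₁_closedBall : ∃ M : ℝ, ∀ s ∈ closedBall (2 : ℂ) (37 / 36), ‖dedekindZeta₁ K s‖ ≤ M :=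
  (isCompact_closedBall (2 : ℂ) (37 / 36)).exists_bound_of_continuousOn
    (dedekindZeta₁_differentiable K).continuous.continuousOn

/-- **`principal_case`**: for `χ_iχ_j` principal and `δ > 0`, `L(1, χ_i) ≥ D(δ)(q_iq_j)^{−δ}L(1, χ_j)`.
[cite: MontgomeryVaughan2007, §11.2 p. 285] -/
theorem principal_case_grossenL {δ : ℝ} (hδ : 0 < δ) : ∃ D : ℝ, 0 < D ∧ ∀ i j : SiegelIdx, SiegelIdx.Principal i j →
    D * ((i.modulus : ℝ) * (j.modulus : ℝ)) ^ (-δ) * (j.L 1).re ≤ (i.L 1).re := by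
  classical
  obtain ⟨C, hC, hprod⟩ := exists_prod_one_sub_inv_absNorm_ge (K := K) (δ := δ / 6) (by positivity)
  refine ⟨C ^ 2, by positivity, fun i j hP => ?_⟩
  -- the moduli
  have hqi := i.one_le
  have hqj := j.one_le
  have hq := one_le_mul hqi hqj
  set 𝔪 : Ideal (𝓞 K) := Ideal.span {((i.modulus * j.modulus : ℕ) : 𝓞 K)} with h𝔪def
  have h𝔪 : 𝔪 ≠ ⊥ := span_natCast_ne_bot_of_one_le hq
  have h𝔪eq : i.mod𝔪 * j.mod𝔪 = 𝔪 := span_natCast_mul_span_natCast _ _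
  have h𝔪eq' : j.mod𝔪 * i.mod𝔪 = 𝔪 := by rw [mul_comm, h𝔪eq]
  -- the bad primes
  obtain ⟨Si, hSi⟩ := exists_finset_primes_le_and_not_le (𝔪₁ := i.mod𝔪) (𝔪₂ := j.mod𝔪) j.mod𝔪_ne_bot
  obtain ⟨Sj, hSj⟩ := exists_finset_primes_le_and_not_le (𝔪₁ := j.mod𝔪) (𝔪₂ := i.mod𝔪) i.mod𝔪_ne_bot
  set T : Finset (HeightOneSpectrum (𝓞 K)) := (Ideal.finite_factors h𝔪).toFinset with hT
  have hSiT : Si ⊆ T := fun v hv => by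
    rw [hT, mem_primeDivisors_toFinset h𝔪, Ideal.dvd_iff_le]
    exact (span_natCast_mul_le_right _ _).trans ((hSi v).mp hv).1
  have hSjT : Sj ⊆ T := fun v hv => by
    rw [hT, mem_primeDivisors_toFinset h𝔪, Ideal.dvd_iff_le]
    exact (span_natCast_mul_le_left _ _).trans ((hSj v).mp hv).1
  -- norms of `ψ` on the bad primes
  have hψi : ∀ v : HeightOneSpectrum (𝓞 K), ¬ i.mod𝔪 ≤ v.asIdeal → ‖i.ψ v‖ ≤ 1 := fun v _ =>
    norm_grossenChar_le i.one_le i.char 0 0 v.asIdeal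
  have hψj : ∀ v : HeightOneSpectrum (𝓞 K), ¬ j.mod𝔪 ≤ v.asIdeal → ‖j.ψ v‖ ≤ 1 := fun v _ =>
    norm_grossenChar_le j.one_le j.char 0 0 v.asIdeal
  have hψiSi : ∀ v ∈ Si, i.ψ v = 1 ∨ i.ψ v = -1 := fun v hv => i.psi_real v ((hSi v).mp hv).2
  have hψjSj : ∀ v ∈ Sj, j.ψ v = 1 ∨ j.ψ v = -1 := fun v hv => j.psi_real v ((hSj v).mp hv).2
  -- the Euler factors
  set Ei : ℂ → ℂ := fun s => ∏ v ∈ Si, (1 - i.ψ v * ((Ideal.absNorm v.asIdeal : ℕ) : ℂ) ^ (-s))⁻¹ with hEi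
  set Ej : ℂ → ℂ := fun s => ∏ v ∈ Sj, (1 - j.ψ v * ((Ideal.absNorm v.asIdeal : ℕ) : ℂ) ^ (-s))⁻¹ with hEj
  have hEid : DifferentiableOn ℂ Ei {s : ℂ | 0 < s.re} :=
    differentiableOn_eulerProd Si fun v _ => norm_grossenChar_le i.one_le i.char 0 0 v.asIdeal
  have hEjd : DifferentiableOn ℂ Ej {s : ℂ | 0 < s.re} :=
    differentiableOn_eulerProd Sj fun v _ => norm_grossenChar_le j.one_le j.char 0 0 v.asIdeal
  -- the identity `L_i E_j = L_j E_i` on `Re s > 1`, then at `s = 1`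
  have hid : ∀ s : ℂ, 1 < s.re → i.L s * Ej s = j.L s * Ei s := by
    intro s hs
    have hLi : i.L s = rayClassLSeries 𝔪 i.ψ s * Ei s := by
      rw [i.L_eq_rayClassLSeries hs, rayClassLSeries_eq_mul_prod i.mod𝔪_ne_bot j.mod𝔪_ne_bot hψi hs hSi, h𝔪eq]
    have hLj : j.L s = rayClassLSeries 𝔪 j.ψ s * Ej s := by
      rw [j.L_eq_rayClassLSeries hs, rayClassLSeries_eq_mul_prod j.mod𝔪_ne_bot i.mod𝔪_ne_bot hψj hs hSj, h𝔪eq']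
    have hcommon : rayClassLSeries 𝔪 i.ψ s = rayClassLSeries 𝔪 j.ψ s :=
      rayClassLSeries_congr h𝔪 (fun v hv => SiegelIdx.psi_eq_of_principal i j hP v hv) s
    rw [hLi, hLj, hcommon]; ring
  have hid1 : i.L 1 * Ej 1 = j.L 1 * Ei 1 := by
    have hsub : {s : ℂ | 8 / 9 < s.re} ⊆ {s : ℂ | 0 < s.re} := fun s hs => by
      simp only [Set.mem_setOf_eq] at hs ⊢; linarith
    refine eqOn_halfPlane_of_eqOn (θ := 8 / 9) (x₀ := 1) (by norm_num) (i.differentiableOn_L.mul (hEjd.mono hsub))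
      (j.differentiableOn_L.mul (hEid.mono hsub)) hid (s := 1) (by norm_num)
  -- real values
  obtain ⟨ei, hei, hei_lo, hei_hi, hei0⟩ := eulerProd_one_real Si hψiSi
  obtain ⟨ej, hej, hej_lo, hej_hi, hej0⟩ := eulerProd_one_real Sj hψjSj
  have hEi1 : Ei 1 = (ei : ℂ) := by rw [hEi]; exact hei
  have hEj1 : Ej 1 = (ej : ℂ) := by rw [hEj]; exact hej
  set li : ℝ := (i.L 1).re with hli
  set lj : ℝ := (j.L 1).re with hlj
  have hli0 : 0 < li := i.L_one_re_pos
  have hlj0 : 0 < lj := j.L_one_re_pos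
  have hreal : li * ej = lj * ei := by
    have h := hid1
    rw [i.L_one_eq_ofReal, j.L_one_eq_ofReal, hEi1, hEj1] at h
    exact_mod_cast h
  -- the product over all primes dividing `q_iq_j`
  set P : ℝ := ∏ v ∈ T, (1 - ((Ideal.absNorm v.asIdeal : ℕ) : ℝ)⁻¹) with hPdef
  have hfac01 : ∀ v : HeightOneSpectrum (𝓞 K), 0 ≤ 1 - ((Ideal.absNorm v.asIdeal : ℕ) : ℝ)⁻¹ ∧
      1 - ((Ideal.absNorm v.asIdeal : ℕ) : ℝ)⁻¹ ≤ 1 := by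
    intro v
    have hw : (2 : ℝ) ≤ (Ideal.absNorm v.asIdeal : ℕ) := by exact_mod_cast two_le_absNorm_heightOne v
    exact ⟨by rw [sub_nonneg]; exact inv_le_one_of_one_le₀ (by linarith), by
      linarith [inv_pos.mpr (show (0 : ℝ) < (Ideal.absNorm v.asIdeal : ℕ) by linarith)]⟩
  have hPSi : P ≤ ∏ v ∈ Si, (1 - ((Ideal.absNorm v.asIdeal : ℕ) : ℝ)⁻¹) :=
    Finset.prod_le_prod_of_subset_of_le_one hSiT (fun v _ => (hfac01 v).1) (fun v _ _ => (hfac01 v).2)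
  have hPSj : P ≤ ∏ v ∈ Sj, (1 - ((Ideal.absNorm v.asIdeal : ℕ) : ℝ)⁻¹) :=
    Finset.prod_le_prod_of_subset_of_le_one hSjT (fun v _ => (hfac01 v).1) (fun v _ _ => (hfac01 v).2)
  have hP0 : 0 ≤ P := Finset.prod_nonneg fun v _ => (hfac01 v).1
  -- `P ≥ C N(𝔪)^{-δ/6} = C (q_iq_j)^{-δ/2}`
  have hPC : C * ((i.modulus : ℝ) * (j.modulus : ℝ)) ^ (-(δ / 2)) ≤ P := by
    have h := hprod 𝔪 h𝔪
    have hN : (Ideal.absNorm 𝔪 : ℝ) = ((i.modulus : ℝ) * (j.modulus : ℝ)) ^ (3 : ℕ) := by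
      rw [h𝔪def, IdealNormCount.absNorm_span_natCast K, finrank_K]; push_cast; ring
    rw [hN, ← Real.rpow_natCast, ← Real.rpow_mul (by positivity)] at h
    convert h using 3
    norm_num; ring
  -- assemble: `li = lj ei/ej ≥ lj P² ≥ lj C² (q_iq_j)^{-δ}`
  have hei_ge : P ≤ ei := hPSi.trans hei_lo
  have hej_le : ej * P ≤ 1 := by
    calc ej * P ≤ ej * ∏ v ∈ Sj, (1 - ((Ideal.absNorm v.asIdeal : ℕ) : ℝ)⁻¹) :=
          mul_le_mul_of_nonneg_left hPSj hej0.le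
      _ ≤ 1 := hej_hi
  have hq0 : (0 : ℝ) < (i.modulus : ℝ) * (j.modulus : ℝ) := by
    have : (1 : ℝ) ≤ i.modulus := by exact_mod_cast hqi
    have : (1 : ℝ) ≤ j.modulus := by exact_mod_cast hqj
    positivity
  have hsq : ((i.modulus : ℝ) * (j.modulus : ℝ)) ^ (-δ) = (((i.modulus : ℝ) * (j.modulus : ℝ)) ^ (-(δ / 2))) ^ 2 := by
    rw [← Real.rpow_natCast, ← Real.rpow_mul hq0.le]; congr 1; push_cast; ring
  rw [hsq]
  have hCP : C ^ 2 * (((i.modulus : ℝ) * (j.modulus : ℝ)) ^ (-(δ / 2))) ^ 2 ≤ P ^ 2 := by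
    rw [← mul_pow]
    exact pow_le_pow_left₀ (by positivity) hPC 2
  -- `li ≥ lj P²`: from `li ej = lj ei`, `ei ≥ P`, `ej P ≤ 1`
  have key : lj * P ^ 2 ≤ li := by
    have h1 : lj * P ^ 2 ≤ lj * (ei * P) := by
      rw [sq]; exact mul_le_mul_of_nonneg_left (mul_le_mul_of_nonneg_right hei_ge hP0) hlj0.le
    have h2 : lj * (ei * P) = li * (ej * P) := by rw [← mul_assoc, ← hreal]; ring
    rw [h2] at h1
    calc lj * P ^ 2 ≤ li * (ej * P) := h1
      _ ≤ li * 1 := mul_le_mul_of_nonneg_left hej_le hli0.le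
      _ = li := mul_one _
  calc C ^ 2 * (((i.modulus : ℝ) * (j.modulus : ℝ)) ^ (-(δ / 2))) ^ 2 * lj
      ≤ P ^ 2 * lj := mul_le_mul_of_nonneg_right hCP hlj0.le
    _ = lj * P ^ 2 := mul_comm _ _
    _ ≤ li := key

/-- **Siegel's family for Heath-Brown's real characters of `ℚ(∛2)`**: the data of Montgomery–Vaughan's
Theorem 11.14 (`SiegelFamilyData`) with `Z = ζ₁_K`, `L_i = L(s, ν^{(0,0)})`, `Q_i = q`, on `|s − 2| ≤ 37/36`.
[cite: MontgomeryVaughan2007, §11.2 Theorem 11.14] -/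
def hbSiegelFamily : SiegelFamilyData SiegelIdx where
  R := 37 / 36
  one_lt_R := by norm_num
  R_le := by norm_num
  U := {s : ℂ | 17 / 18 < s.re}
  isOpen_U := isOpen_lt continuous_const Complex.continuous_re
  closedBall_subset s hs := by
    have h := (bounds_of_mem_closedBall hs).1
    simp only [Set.mem_setOf_eq]; linarith
  Z := dedekindZeta₁ K
  differentiableOn_Z := (dedekindZeta₁_differentiable K).differentiableOn
  MZ := exists_bound_dedekindZeta₁_closedBall.choose
  norm_Z_le := exists_bound_dedekindZeta₁_closedBall.choose_spec
  Z_im σ _ := dedekindZeta₁_ofReal_im σ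
  Z_one_pos := by rw [dedekindZeta₁_apply_one, Complex.ofReal_re]; exact dedekindZeta_residue_pos K
  Z_pos σ h1 _ := dedekindZeta₁_ofReal_re_pos h1
  Q i := (i.modulus : ℝ)
  one_le_Q i := by exact_mod_cast i.one_le
  L i := i.L
  differentiableOn_L i := i.differentiableOn_L.mono fun s hs => by
    simp only [Set.mem_setOf_eq] at hs ⊢; linarith
  B := exists_bound_L_closedBall.choose
  κ := 3
  B_nonneg := exists_bound_L_closedBall.choose_spec.1
  κ_nonneg := by norm_num
  norm_L_le i s hs := exists_bound_L_closedBall.choose_spec.2 i s hs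
  L_im i σ hσ := i.L_ofReal_im (by have h := (bounds_of_mem_closedBall hσ).1; rw [Complex.ofReal_re] at h; linarith)
  L_one_ne i := i.L_one_ne_zero
  coeff₁ i := i.exists_coeff₁
  mul := SiegelIdx.mul
  Principal := SiegelIdx.Principal
  Q_mul_le i j := SiegelIdx.modulus_mul_le i j
  coeff₃ i j hP := by
    obtain ⟨a, ha0, ha1, hsum, hL⟩ := SiegelIdealCoefficients.exists_nonneg_coeff_rayClass i.mod𝔪_ne_bot j.mod𝔪_ne_bot
      i.psi_real j.psi_real
    refine ⟨a, ha0, ha1, hsum, fun s hs => ?_⟩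
    rw [hL s hs, dedekindZeta₁_apply_eq_mul hs, i.L_eq_rayClassLSeries hs, j.L_eq_rayClassLSeries hs,
      SiegelIdx.L_mul_eq i j hP hs]
    ring
  L_one_le δ hδ := by
    obtain ⟨r, hr, T, hT⟩ := hloc_grossenL δ hδ
    exact ⟨T, fun i => hT i 1 (by rw [Complex.one_im, abs_zero]; exact hr.le) (by rw [Complex.one_re]; linarith)
      (by rw [Complex.one_re]; linarith)⟩
  principal_case δ hδ := principal_case_grossenL hδ

/-- **Siegel's real-zero bound for Heath-Brown's real characters** (MV Cor. 11.15 over `ℚ(∛2)`): for every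
`ε > 0` there is `C(ε) > 0` such that `C(ε) q^{−ε} ≤ 1 − β` for every `q ≥ 1`, every `χ mod q` with `χ² = 1`,
`χ ≠ χ₀`, `χ(u_E) = 1`, and every real `β ∈ (17/18, 1]` with `L(β, ν^{(0,0)}) = 0` (the case `β = 1` being
excluded by `L(1, χ) ≠ 0`). This is the hypothesis `hS` of `grossenCharPNT_of_realZero_bound`.
[cite: MontgomeryVaughan2007, §11.2 Corollary 11.15] -/
theorem realZero_bound_grossenL (ε : ℝ) (hε : 0 < ε) : ∃ Cε : ℝ, 0 < Cε ∧ ∀ (q : ℕ) (hq : 1 ≤ q)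
    (χ : MulChar (QuotMod q) ℂ), χ ^ 2 = 1 → χ ≠ 1 → charAngle χ = 0 → ∀ β : ℝ, 17 / 18 < β → β ≤ 1 →
      grossenL hq χ 0 0 β = 0 → Cε * (q : ℝ) ^ (-ε) ≤ 1 - β := by
  obtain ⟨C, hC, h⟩ := hbSiegelFamily.realZero_bound
    (fun δ hδ => by
      obtain ⟨r, hr, T, hT⟩ := hloc_grossenL δ hδ
      exact ⟨r, hr, T, fun i z h1 h2 h3 => hT i z h1 h2 h3⟩) hε
  refine ⟨C, hC, fun q hq χ h2 hne ht β hβ hβ1 hzero => ?_⟩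
  set i : SiegelIdx := ⟨⟨q, χ⟩, hq, h2, hne, ht⟩ with hi
  rcases hβ1.lt_or_eq with hβ1 | hβ1
  · exact h i β hβ1 hzero
  · exfalso
    rw [hβ1] at hzero
    exact i.L_one_ne_zero (by simpa using hzero)

/-- **Heath-Brown's Lemma 9.4 / Mitsui's Lemma 5 for `K = ℚ(∛2)`, unconditionally**: for every `A > 0` there are
`c > 0`, `C`, `z₀` with `‖θ_ν(z)‖ ≤ C z exp(−c√(log z))` for `z ≥ z₀`, `1 ≤ q ≤ (log z)^A`,
`|j|, |k| ≤ exp(c√(log z))`, `ν^{(j,k)}` non-trivial `mod q` (`GrossenCharPNT A c C z₀`) — in the shape consumed by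
`HeathBrown2001_lemma_3_8_of_lemma94`. [cite: HeathBrownActa2001, §9 Lemma 9.4] -/
theorem grossenCharPNT_holds (A : ℝ) (hA : 0 < A) : ∃ c C z₀ : ℝ, 0 < c ∧ GrossenCharPNT A c C z₀ := by
  obtain ⟨c, hc, C, z₀, h⟩ := grossenCharPNT_of_realZero_bound realZero_bound_grossenL A hA
  exact ⟨c, C, z₀, hc, h⟩

end Literature.NumberTheory.Sieve.CubicSieve

end
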